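import Summits.HubbardSuperconductivity.HubbardSuperconductivity.Theses.PlaquetteBoson
import Summits.HubbardSuperconductivity.HubbardSuperconductivity.Theses.AnisotropyChord
import Summits.HubbardSuperconductivity.HubbardSuperconductivity.Theses.PolyaSchurPairBoson
import Literature.MathematicalPhysics.QuantumLattice.PairFieldMomentum
import Literature.MathematicalPhysics.QuantumLattice.PlaquettePairCouplings
import HarnessLib

/-!
# Crux `PbAnchorOrder` (stmt-HubbardSuperconductivity-0905) — STRATEGY CENSUS, companion Lean file
(crux-strategist `planner-cstrat-stmt-HubbardSuperconductivity-0905-s2-0`, 2026-08-17; goes with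
`Cruxes/PbAnchorOrder/STRATEGY-CENSUS.md`). Typed forms of the statements attempted under the four census
headings, so that "strengthen / decomposition / negation" are signatures and not prose. Nothing here is a
route item; no Literature definition is introduced (the three `def`s of §0 are local vocabulary copied from
`Lines/birth.lean`, over existing declarations). `sorry`-free.

* §0 vocabulary: `checkerboardHamiltonian`, `AnchorOrderAt U δ` (the crux body at fixed `(U, δ)`;
  `pbAnchorOrder_iff : PbAnchorOrder ↔ ∃ U > 0, ∃ δ ∈ (0,1/2), AnchorOrderAt U δ` by `Iff.rfl`).
* §1 DECOMPOSITION (the split filed): `PbAnchorOrder ⟸ PbHalfFilledXYOrder ∧ AnisotropyChord.DressHalfFilled`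
  — `AnisotropyChord.DressHalfFilled` (stmt-8148) is BY `Iff.rfl` the implication stmt-0906 → stmt-0905
  (`dressHalfFilled_iff`, `PbAnchorOrder_of_subs`); and the any-filling corner through
  `PolyaSchurPairBoson.DressAnyFilling` (stmt-10291) / `EasyPlaneCondensate` (stmt-10288).
* §2 STRENGTHEN: `PbAnchorOrderUniform` (constants uniform in `t'`), `PbAnchorOrderUnique` (nondegenerate
  sector floor + LRO), `PbAnchorIRCeiling` (every floor state obeys an integrable infrared ceiling on the
  `d`-wave pair structure factor — the infrared residue in this crux's clothes); each implies or sits beside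
  the crux, none is inductively closed (census §Strengthen).
* §3 NEGATION: `PbAnchorOrderAtZeroU` (the `U = 0` variant, expected FALSE: Wick), `PbAnchorOrderAllU`
  (the `∀ U` variant, expected false beyond the pair-binding window), and the one landable negative-side
  lemma `NoFiniteMomentumPairCondensateAt` (inherited Gaussian domination + Koma–Tasaki tower ⇒ no
  macroscopic pair condensate at momenta `|q| ≳ t'`, at boson half filling).

Sources: H. Yao, W.-F. Tsai, S. A. Kivelson, PRB 76 (2007) 161104(R) [YaoTsaiKivelson2007]; T. Kennedy,
E. H. Lieb, B. S. Shastry, PRL 61 (1988) 2582 [KLS1988PRL]; T. Koma, H. Tasaki, J. Stat. Phys. 76 (1994)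
745 [KomaTasaki1994]; F. J. Dyson, E. H. Lieb, B. Simon, J. Stat. Phys. 18 (1978) 335 [DysonLiebSimon1978].
-/

noncomputable section

set_option linter.dupNamespace false

namespace Summit.HubbardSuperconductivity.HubbardSuperconductivity.Cruxes.PbAnchorOrder.StrategyCensus

open Matrix Finset
open Literature.Probability.LatticeModels Literature.MathematicalPhysics.QuantumLattice
open Summit.HubbardSuperconductivity.HubbardSuperconductivity.Theses
open Summit.HubbardSuperconductivity.HubbardSuperconductivity.Theses.PlaquetteBoson
  (PbAnchorOrder PbMonotoneDepletion PbHalfFilledXYOrder PbInterpolation)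
open scoped ComplexOrder

/-! ## §0 Vocabulary (verbatim from `Lines/birth.lean`) -/

/-- The checkerboard Hubbard torus `H_L(t', U)` of the crux (intra-plaquette hopping `1` and on-site `U`,
inter-plaquette hopping `t'`). Yao–Tsai–Kivelson 2007, eq. (1). -/
def checkerboardHamiltonian (L : ℕ) (t' U : ℝ) :
    Matrix (Finset (Orb (FermionTorus 2 L))) (Finset (Orb (FermionTorus 2 L))) ℂ :=
  hamiltonian ((fermionTorusGraph 2 L) \ SimpleGraph.comap
      (fun x : FermionTorus 2 L => fun i : Fin 2 => ((ofLex x) i : ℕ) / 2) ⊤) 1 U +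
    hamiltonian ((fermionTorusGraph 2 L) ⊓ SimpleGraph.comap
      (fun x : FermionTorus 2 L => fun i : Fin 2 => ((ofLex x) i : ℕ) / 2) ⊤) t' 0

/-- `AnchorOrderAt U δ`: the crux body at fixed `(U, δ)`. -/
def AnchorOrderAt (U δ : ℝ) : Prop :=
  ∃ t₀ : ℝ, 0 < t₀ ∧ ∀ t' ∈ Set.Ioo (0:ℝ) t₀, ∃ c : ℝ, 0 < c ∧ ∃ L₀ : ℕ, ∀ (L : ℕ) [NeZero L],
    L₀ ≤ L → 4 ∣ L → ∀ (N : ℕ) (ψ : Fock (Orb (FermionTorus 2 L))),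
      N = 2 * ⌊(1 - δ) * (L : ℝ) ^ 2 / 2⌋₊ → star ψ ⬝ᵥ ψ = 1 →
      IsGroundStateInSector (checkerboardHamiltonian L t' U) N 0 ψ →
      c * (L : ℝ) ^ 4 ≤ (expect ((pairField dWaveFormFactor L)ᴴ * pairField dWaveFormFactor L) ψ).re

/-- The crux unfolds to `∃ U > 0, ∃ δ ∈ (0,1/2), AnchorOrderAt U δ`. [bookkeeping] -/
theorem pbAnchorOrder_iff :
    PbAnchorOrder ↔ ∃ U : ℝ, 0 < U ∧ ∃ δ ∈ Set.Ioo (0:ℝ) (1/2), AnchorOrderAt U δ :=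
  Iff.rfl

/-! ## §1 DECOMPOSITION — the split that was filed, and the dissection into existing items -/

/-- `AnisotropyChord.DressHalfFilled` (stmt-8148) IS `PbHalfFilledXYOrder → PbAnchorOrder`
(stmt-0906 → stmt-0905), by `Iff.rfl`. [bookkeeping] -/
theorem dressHalfFilled_iff :
    AnisotropyChord.DressHalfFilled ↔ (PbHalfFilledXYOrder → PbAnchorOrder) :=
  Iff.rfl

/-- `PolyaSchurPairBoson.DressAnyFilling` (stmt-10291) IS `EasyPlaneCondensate → PbAnchorOrder`
(stmt-10288 → stmt-0905), by `Iff.rfl`. [bookkeeping] -/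
theorem dressAnyFilling_iff :
    PolyaSchurPairBoson.DressAnyFilling ↔ (PolyaSchurPairBoson.EasyPlaneCondensate → PbAnchorOrder) :=
  Iff.rfl

/-- **D3, the filed split** `PbAnchorOrder ⟸ PbHalfFilledXYOrder ∧ DressHalfFilled` (modus ponens; witness
doping `δ = 1/4` = boson half filling, the reflection-positive `S^z_tot = 0` sector). [bookkeeping] -/
theorem PbAnchorOrder_of_subs (hHF : PbHalfFilledXYOrder) (hD : AnisotropyChord.DressHalfFilled) :
    PbAnchorOrder :=
  dressHalfFilled_iff.mp hD hHF

/-- **D2** `PbAnchorOrder ⟸ EasyPlaneCondensate ∧ DressAnyFilling` (stmt-10288 ∧ stmt-10291). [bookkeeping] -/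
theorem PbAnchorOrder_of_psb (hEP : PolyaSchurPairBoson.EasyPlaneCondensate)
    (hDA : PolyaSchurPairBoson.DressAnyFilling) : PbAnchorOrder :=
  dressAnyFilling_iff.mp hDA hEP

/-! ## §2 STRENGTHEN — typed `S⁺` candidates -/

/-- **S1 `PbAnchorOrderUniform`** — the LRO constant and the volume threshold uniform in `t' ∈ (0, t₀)`
(`∃ c L₀ ∀ t'` instead of `∀ t' ∃ c L₀`). Plausibly TRUE (the leading condensate density
`c(U)²·m_eff²/16` does not depend on `t'`), strictly stronger, but with no inductive or compactness handle:
the uniformity is an OUTPUT of any proof of the crux with explicit constants, never an input. -/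
def PbAnchorOrderUniform : Prop :=
  ∃ U : ℝ, 0 < U ∧ ∃ δ ∈ Set.Ioo (0:ℝ) (1/2), ∃ t₀ : ℝ, 0 < t₀ ∧ ∃ c : ℝ, 0 < c ∧ ∃ L₀ : ℕ,
    ∀ t' ∈ Set.Ioo (0:ℝ) t₀, ∀ (L : ℕ) [NeZero L], L₀ ≤ L → 4 ∣ L →
      ∀ (N : ℕ) (ψ : Fock (Orb (FermionTorus 2 L))),
        N = 2 * ⌊(1 - δ) * (L : ℝ) ^ 2 / 2⌋₊ → star ψ ⬝ᵥ ψ = 1 →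
        IsGroundStateInSector (checkerboardHamiltonian L t' U) N 0 ψ →
        c * (L : ℝ) ^ 4 ≤ (expect ((pairField dWaveFormFactor L)ᴴ * pairField dWaveFormFactor L) ψ).re

/-- S1 ⇒ crux (quantifier shuffle). [bookkeeping] -/
theorem pbAnchorOrder_of_uniform (h : PbAnchorOrderUniform) : PbAnchorOrder := by
  obtain ⟨U, hU, δ, hδ, t₀, ht₀, c, hc, L₀, h⟩ := h
  exact ⟨U, hU, δ, hδ, t₀, ht₀, fun t' ht' => ⟨c, hc, L₀, fun L _ hL h4 N ψ hN hψ hG =>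
    h t' ht' L hL h4 N ψ hN hψ hG⟩⟩

/-- **S2 `PbAnchorOrderUnique`** — the sector floor is NONDEGENERATE (eventually in `L ∈ 4ℕ`, at each small
`t'`) and the unique floor state has LRO. Rigidity bought: "every ground state" becomes "the ground state",
so Perron–Frobenius-type and analytic-branch (Kato) arguments become available; NOT bought: uniqueness of the
full fermionic floor at fixed `t' > 0` uniformly in `L` is itself a gapless-stability statement (sector gap
of the dressed gas `∼ J t'²/L` against an extensive remainder), i.e. the same wall as the crux. -/
def PbAnchorOrderUnique : Prop :=
  ∃ U : ℝ, 0 < U ∧ ∃ δ ∈ Set.Ioo (0:ℝ) (1/2), ∃ t₀ : ℝ, 0 < t₀ ∧ ∀ t' ∈ Set.Ioo (0:ℝ) t₀,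
    ∃ c : ℝ, 0 < c ∧ ∃ L₀ : ℕ, ∀ (L : ℕ) [NeZero L], L₀ ≤ L → 4 ∣ L → ∀ (N : ℕ),
      N = 2 * ⌊(1 - δ) * (L : ℝ) ^ 2 / 2⌋₊ →
      (∀ ψ₁ ψ₂ : Fock (Orb (FermionTorus 2 L)),
          IsGroundStateInSector (checkerboardHamiltonian L t' U) N 0 ψ₁ →
          IsGroundStateInSector (checkerboardHamiltonian L t' U) N 0 ψ₂ → ∃ a : ℂ, ψ₂ = a • ψ₁) ∧
      (∀ ψ : Fock (Orb (FermionTorus 2 L)), star ψ ⬝ᵥ ψ = 1 →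
          IsGroundStateInSector (checkerboardHamiltonian L t' U) N 0 ψ →
          c * (L : ℝ) ^ 4 ≤ (expect ((pairField dWaveFormFactor L)ᴴ * pairField dWaveFormFactor L) ψ).re)

/-- S2 ⇒ crux (drop the uniqueness clause). [bookkeeping] -/
theorem pbAnchorOrder_of_unique (h : PbAnchorOrderUnique) : PbAnchorOrder := by
  obtain ⟨U, hU, δ, hδ, t₀, ht₀, h⟩ := h
  refine ⟨U, hU, δ, hδ, t₀, ht₀, fun t' ht' => ?_⟩
  obtain ⟨c, hc, L₀, hL⟩ := h t' ht'
  exact ⟨c, hc, L₀, fun L _ hL0 h4 N ψ hN hψ hG => (hL L hL0 h4 N hN).2 ψ hψ hG⟩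

/-- **S3 `PbAnchorIRCeiling`** — THE INFRARED RESIDUE in this crux's clothes (KLS-output form): at some
`(U, δ)`, for all small `t'`, every sector floor state obeys an integrable infrared ceiling on the `d`-wave
pair structure factor at nonzero momenta, `S_ψ(m) ≤ B / |q_m|` (`pairStructureFactor`, `momentumNormSq`
of `PairFieldMomentum.lean`; `|q_m|⁻¹` is summable against `L⁻²Σ_m` in `d = 2`). Together with a
finite-range order floor it gives the crux by the smeared (Fejér) closure; ALONE it does not (no order
input). It is what reflection positivity + Gaussian domination deliver for the REFERENCE XXZ gas and exactly
what the inherited (defective) Gaussian domination of the dressed model fails to deliver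
(census §Transfer T2 / §Strengthen S3): no rigidity for THIS step. -/
def PbAnchorIRCeiling : Prop :=
  ∃ U : ℝ, 0 < U ∧ ∃ δ ∈ Set.Ioo (0:ℝ) (1/2), ∃ t₀ : ℝ, 0 < t₀ ∧ ∀ t' ∈ Set.Ioo (0:ℝ) t₀,
    ∃ B : ℝ, ∃ L₀ : ℕ, ∀ (L : ℕ) [NeZero L], L₀ ≤ L → 4 ∣ L →
      ∀ (N : ℕ) (ψ : Fock (Orb (FermionTorus 2 L))),
        N = 2 * ⌊(1 - δ) * (L : ℝ) ^ 2 / 2⌋₊ → star ψ ⬝ᵥ ψ = 1 →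
        IsGroundStateInSector (checkerboardHamiltonian L t' U) N 0 ψ →
        ∀ m : TorusSite 2 L, m ≠ 0 →
          pairStructureFactor dWaveFormFactor L ψ m * Real.sqrt (momentumNormSq L m) ≤ B

/-! ## §3 NEGATION — typed variants and the one landable negative-side lemma -/

/-- **N1 `PbAnchorOrderAtZeroU`** — the `U = 0` variant (free fermions on the checkerboard torus).
EXPECTED FALSE (Wick: `⟨Δ_d†Δ_d⟩ = O(L²)` for quasi-free states; a floor shell of `O(1)` degeneracy adds
`O(L²)`), recorded as a disprover target `¬ PbAnchorOrderAtZeroU`; what it would certify — "any proof uses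
`U > 0`" — is already the catalogue entry `GeneralizedHartreeFockNoPairing`, so it carries little. -/
def PbAnchorOrderAtZeroU : Prop :=
  ∃ δ ∈ Set.Ioo (0:ℝ) (1/2), AnchorOrderAt 0 δ

/-- **N2 `PbAnchorOrderAllU`** — the `∀ U > 0` variant (some doping and hopping window for EVERY
repulsion). Expected false for `U > U_c ≈ 4.58` (no plaquette pair binding: the `t'`-scale low-energy
manifold is a dilute gas of single holes, not of `B₁g` pairs), but a proof of ABSENCE of `d`-wave LRO there
is as unavailable as the crux (no tool bounds pair LRO of an interacting floor from above off quasi-free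
states); not a usable target. -/
def PbAnchorOrderAllU : Prop :=
  ∀ U : ℝ, 0 < U → ∃ δ ∈ Set.Ioo (0:ℝ) (1/2), AnchorOrderAt U δ

/-- N2 ⇒ crux at any positive `U` (e.g. `U = 1`). [bookkeeping] -/
theorem pbAnchorOrder_of_allU (h : PbAnchorOrderAllU) : PbAnchorOrder :=
  let ⟨δ, hδ, hA⟩ := h 1 one_pos
  pbAnchorOrder_iff.2 ⟨1, one_pos, δ, hδ, hA⟩

/-- **N3 `NoFiniteMomentumPairCondensateAt U`** — the landable NEGATIVE-SIDE lemma of the census (inherited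
Gaussian domination in energy form + the Koma–Tasaki tower): at boson half filling `δ = 1/4` (the
reflection-positive sector of the reference gas) and small `t'`, NO sector floor state of the checkerboard
torus carries a macroscopic `d`-wave pair condensate at a momentum `|q_m| ≥ η`: its structure factor there
is `≤ (C t'² / η² + ε) L²` eventually in `L`, for every `η, ε > 0` (`t'²` = the size of the Schrieffer–Wolff
remainder RELATIVE to the `t'²`-scale reference after the plaquette-parity gauge). It excludes the
finite-momentum failure mode (the `KlsOrderOpenness` helix) energetically, but says nothing at `q = 0` and is
not an infrared ceiling (it does not control the SUM over small momenta) — census §Negation N3. -/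
def NoFiniteMomentumPairCondensateAt (U : ℝ) : Prop :=
  ∃ C t₀ : ℝ, 0 < t₀ ∧ ∀ t' ∈ Set.Ioo (0:ℝ) t₀, ∀ η : ℝ, 0 < η → ∀ ε : ℝ, 0 < ε → ∃ L₀ : ℕ,
    ∀ (L : ℕ) [NeZero L], L₀ ≤ L → 4 ∣ L → ∀ (N : ℕ) (ψ : Fock (Orb (FermionTorus 2 L))),
      N = 2 * ⌊(1 - (1/4 : ℝ)) * (L : ℝ) ^ 2 / 2⌋₊ → star ψ ⬝ᵥ ψ = 1 →
      IsGroundStateInSector (checkerboardHamiltonian L t' U) N 0 ψ →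
      ∀ m : TorusSite 2 L, η ^ 2 ≤ momentumNormSq L m →
        pairStructureFactor dWaveFormFactor L ψ m ≤ (C * t' ^ 2 / η ^ 2 + ε) * (L : ℝ) ^ 2

end Summit.HubbardSuperconductivity.HubbardSuperconductivity.Cruxes.PbAnchorOrder.StrategyCensus

end
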